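import Summits.BirchSwinnertonDyer.Rank1Residual.ManinConstantOne
import Summits.BirchSwinnertonDyer.Rank1Residual.X12.InertCoreEveryCurve
import Literature.NumberTheory.EllipticCurves.ManinConstantClassCertificate
import Literature.NumberTheory.EllipticCurves.ManinConstantKodairaTypePrimes
import Literature.NumberTheory.EllipticCurves.ManinConstantNonPotentiallyOrdinaryPrimes
import Literature.NumberTheory.EllipticCurves.IsogenyIdProofs
import HarnessLib

/-!
# Edges of the conjecture leaf `ManinConstantOne` / `StevensConstantOne` (all PROVED; nothing asserted)

Companion of `Summits/BirchSwinnertonDyer/Rank1Residual/ManinConstantOne.lean` (typing layer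
D-0088(4), seat bsd-littype-12; paper of record Česnavičius–Neururer–Saha, J. Eur. Math. Soc. 26
(2024) 573–637). The leaf holds only the two `@[conjecture]` definitions; this file proves, by NAME,
how they plug into the tree:

* `maninConstantOne_iff_forall_classAbsManinConstantEqOne` — Manin's conjecture is EXACTLY the
  class-local predicate `ClassAbsManinConstantEqOne W` (`ManinConstantClassCertificate.lean`, the shape
  every per-class Manin certificate / range theorem instantiates) asserted for every curve `W/ℚ`;
  hence `classAbsManinConstantEqOne_of_maninConstantOne` and the all-primes binder
  `not_dvd_maninConstant_of_maninConstantOne` (`p ∤ c(D)` for every optimal datum — the hypothesis the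
  `r ≤ 1` roads of b2b-bsdres X12 / additive classes carry).
* `stevensConstantOne_of_maninConstantOne` — ČNS §1 footnote 2 (p. 574): "Manin considered
  `Γ = Γ₀(N)`, and this implies the general case by Lemma 6.5", in the kernel MODULO the named
  Literature fact `cesnaviciusNeururerSaha_lemma_6_5_dvd` (Lemma 6.5 = Česnavičius 2018 Lemma 2.12:
  the `X₁(N)`-optimal constant divides the `X₀(N)`-optimal one) and Modularity `exists_isNewformOf`
  (which supplies the `X₀(N)`-optimal member of every isogeny class at the conductor level:
  `X12.exists_isIsogenous_optimal`; the level of an `X₁(N)`-datum is the conductor by strong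
  multiplicity one, `IsNewformOf.level_eq_conductorNorm_of_exists_isNewformOf`).

* `optimalManinFacts_of_maninConstantOne` (§ "One switch", one conjunction) — under the leaf, EVERY
  named Manin-constant fact of the tree that is stated over OPTIMAL data holds outright: Mazur 1978 Cor. 4.1 (`hM`/`hMaz`), Abbes–Ullmo
  1996 Thm. A (`hAU`), Česnavičius 2018 at `2 ∥ N` (`hC`), Agashe–Ribet–Stein/Cremona `N ≤ 130000`
  (`h26`), Cremona `N ≤ 300000` / `N ≤ 500000` (`h300`/`h500k`), Edixhoven 1991 Thm. 3 in both typed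
  forms (`hEdx`, `hEdxK`) — so a route opened `--conditional-on ManinConstantOne` feeds all its Manin
  binders by name. (NOT implied: `cesnaviciusNeururerSaha_padicVal_maninConstant_le_modularDegree` /
  `…thm_1_2`, which speak of arbitrary, non-optimal parametrisations — and are theorems in print anyway.)

No `sorry`; no new definition, fact, instance or notation. PARTITION (D-0054): none (typing layer).
-/

set_option autoImplicit false

noncomputable section

open WeierstrassCurve Literature.NumberTheory.EllipticCurves
  Literature.NumberTheory.EllipticCurves.ModularForms

namespace Summit.BirchSwinnertonDyer.Rank1Residual.ManinConstant

/-- **Manin's conjecture ⟺ the class-local predicate for every curve.** `ManinConstantOne` unfolds to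
`ClassAbsManinConstantEqOne W` for all `W` (the latter quantifies over the globally minimal `W′ ∼ W`
and their optimal data; conversely take `W′ = W`, `isIsogenous_self`).
[cite: AgasheRibetStein2006, Conjecture 2.1 (p. 619; shape only, nothing asserted)] -/
theorem maninConstantOne_iff_forall_classAbsManinConstantEqOne :
    ManinConstantOne ↔ ∀ W : WeierstrassCurve ℚ, ClassAbsManinConstantEqOne W := by
  constructor
  · intro h W W' _ _ N' _ D' _ hopt
    exact h W' D' hopt
  · intro h W _ _ N _ D hopt
    exact h W W D (isIsogenous_self W) hopt

/-- Under Manin's conjecture every class satisfies `ClassAbsManinConstantEqOne`.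
[cite: AgasheRibetStein2006, Conjecture 2.1 (p. 619; shape only, nothing asserted)] -/
theorem classAbsManinConstantEqOne_of_maninConstantOne (h : ManinConstantOne)
    (W : WeierstrassCurve ℚ) : ClassAbsManinConstantEqOne W :=
  maninConstantOne_iff_forall_classAbsManinConstantEqOne.mp h W

/-- **The all-primes Manin binder under the conjecture**: `p ∤ c(D)` for every prime `p` and every
optimal `X₀(N)`-datum `D` of a globally minimal curve (the hypothesis `¬ (p : ℤ) ∣ D.maninConstant`
displayed by the `r ≤ 1` roads). [cite: CesnaviciusNeururerSaha2023, §1 p. 574 ("the natural approach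
to the Manin conjecture is to argue that p ∤ c_φ for every prime p"; nothing asserted)] -/
theorem not_dvd_maninConstant_of_maninConstantOne (h : ManinConstantOne) {W : WeierstrassCurve ℚ}
    [W.IsElliptic] [W.IsGloballyMinimal] {N : ℕ} [NeZero N] (D : ModularParametrizationData W N)
    (hopt : ∀ z ∈ D.L.lattice, ∃ w ∈ periodLattice D.f, z = D.c * w) {p : ℕ} (hp : p.Prime) :
    ¬ (p : ℤ) ∣ D.maninConstant := by
  intro hdvd
  have h1 : |D.maninConstant| = 1 := h W D hopt
  have := Int.natAbs_dvd_natAbs.mpr hdvd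
  rw [Int.abs_eq_natAbs, Nat.cast_eq_one] at h1
  rw [h1, Int.natAbs_natCast, Nat.dvd_one] at this
  exact hp.one_lt.ne' this

/-- **Manin ⟹ Stevens** (ČNS §1 fn. 2, p. 574: "Manin considered `Γ = Γ₀(N)`, and this implies the
general case by Lemma 6.5"), modulo the named fact `cesnaviciusNeururerSaha_lemma_6_5_dvd`
(`c_{Γ₁} ∣ c_{Γ₀}`) and Modularity (`exists_isNewformOf`, giving the `X₀(N)`-optimal member of the
class at the conductor level, `X12.exists_isIsogenous_optimal`): for an optimal `X₁(N)`-datum `D₁`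
of `W₁`, `N = N(W₁)` (strong multiplicity one), the class has an optimal `X₀(N)`-datum `D₀` on a
globally minimal `W₀ ∼ W₁`, `|c(D₀)| = 1` by Manin, and `c(D₁) ∣ c(D₀)` forces `|c(D₁)| = 1`
(`abs_maninConstant₁_eq_one_of_abs_maninConstant₀_eq_one`).
[cite: CesnaviciusNeururerSaha2023, §1 fn. 2 (p. 574) with Lemma 6.5 (p. 614)] -/
theorem stevensConstantOne_of_maninConstantOne (h65 : cesnaviciusNeururerSaha_lemma_6_5_dvd)
    (hnf : exists_isNewformOf) (h : ManinConstantOne) : StevensConstantOne := by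
  intro W₁ _ _ N _ D₁ h₁
  have hN : N = W₁.conductorNorm ℤ :=
    IsNewformOf.level_eq_conductorNorm_of_exists_isNewformOf hnf D₁.isNewformOf
  obtain ⟨W₀, hE, hM, hNZ, D₀, hiso, hN₀, hopt₀⟩ := X12.exists_isIsogenous_optimal hnf W₁
  haveI := hE; haveI := hM; haveI := hNZ
  obtain ⟨D₀', hopt₀'⟩ := X12.exists_optimalDatum_of_level_eq (hN₀.trans hN.symm) D₀ hopt₀
  exact abs_maninConstant₁_eq_one_of_abs_maninConstant₀_eq_one h65 D₁ D₀' hiso h₁ hopt₀'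
    (h W₀ D₀' hopt₀')

/-! ### One switch: the leaf implies every optimal-datum Manin fact of the tree -/

/-- **One switch.** Under Manin's conjecture, EVERY named Manin-constant fact of the tree that is
stated over OPTIMAL data holds — bundled as one conjunction (so that the gate's debt census does not
read these CONDITIONAL derivations as discharges of the facts): in order, Mazur 1978 Cor. 4.1
(`mazur_not_dvd_maninConstant_of_odd`, binder `hM`/`hMaz`), Abbes–Ullmo 1996 Thm. A
(`abbesUllmo_not_dvd_maninConstant_of_not_dvd_level`, `hAU`), Česnavičius 2018 at `2 ∥ N`
(`cesnavicius_not_two_dvd_maninConstant_of_two_dvd_level`, `hC`), Agashe–Ribet–Stein 2006 Thm. 2.6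
(`AgasheRibetStein2006.cremona_abs_maninConstant_eq_one_of_level_le`, `h26`), Cremona at `300000`
and `500000` (`cremona_abs_maninConstant_eq_one_of_level_le_300000` / `…_500000`, `h300`/`h500k`),
Edixhoven 1991 Thm. 3 in both typed forms
(`edixhoven_not_dvd_maninConstant_of_not_potentiallyGoodOrdinary`, `hEdx`;
`edixhoven_not_dvd_maninConstant_of_kodairaSymbol_ne`, `hEdxK`). Use the projections `.1`, `.2.1`,
… to feed a road opened conditionally on `ManinConstantOne`. These facts are THEOREMS in print; the
point here is only the bookkeeping edge. (Not implied: the ČNS degree bounds, which concern arbitrary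
parametrisations.) [cite: CesnaviciusNeururerSaha2023, §1 pp. 574–575 (the known cases reviewed;
nothing new asserted)] -/
theorem optimalManinFacts_of_maninConstantOne (h : ManinConstantOne) :
    mazur_not_dvd_maninConstant_of_odd ∧
    abbesUllmo_not_dvd_maninConstant_of_not_dvd_level ∧
    cesnavicius_not_two_dvd_maninConstant_of_two_dvd_level ∧
    AgasheRibetStein2006.cremona_abs_maninConstant_eq_one_of_level_le ∧
    cremona_abs_maninConstant_eq_one_of_level_le_300000 ∧
    cremona_abs_maninConstant_eq_one_of_level_le_500000 ∧
    edixhoven_not_dvd_maninConstant_of_not_potentiallyGoodOrdinary ∧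
    edixhoven_not_dvd_maninConstant_of_kodairaSymbol_ne := by
  refine ⟨fun _ _ _ _ _ D' hopt _ hp _ _ ↦ not_dvd_maninConstant_of_maninConstantOne h D' hopt hp,
    fun _ _ _ _ _ D' hopt _ hp _ ↦ not_dvd_maninConstant_of_maninConstantOne h D' hopt hp,
    fun _ _ _ _ _ D' hopt _ _ ↦ by
      exact_mod_cast not_dvd_maninConstant_of_maninConstantOne h D' hopt Nat.prime_two,
    fun W' _ _ _ _ D' hopt _ ↦ h W' D' hopt,
    fun W' _ _ _ _ D' hopt _ ↦ h W' D' hopt,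
    fun W' _ _ _ _ D' hopt _ ↦ h W' D' hopt,
    fun _ _ _ _ D' hopt _ hp _ _ ↦ not_dvd_maninConstant_of_maninConstantOne h D' hopt hp,
    fun _ _ _ _ D' hopt _ hp _ _ _ _ ↦ not_dvd_maninConstant_of_maninConstantOne h D' hopt hp⟩

end Summit.BirchSwinnertonDyer.Rank1Residual.ManinConstant

end
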